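/-
Copyright: statement-level skeleton of a published paper (lit-balaban cell, Phase-2 proof seat p26 gen 45). No claims beyond
what the kernel checks below.
-/
import Mathlib
import Literature.MathematicalPhysics.QuantumFieldTheory.Balaban1983to89.B1Eq211ZeroFieldTorusLevels
import Literature.MathematicalPhysics.QuantumFieldTheory.Balaban1983to89.B3Ineq213Points

/-!
# B3 — T. Bałaban, *(Higgs)₂,₃ quantum fields in a finite volume. III. Renormalization*, CMP **88** (1983) 411–445
[Balaban1983Higgs3] — p. 426 [PDF 16] (2.10) and (2.13), with the torus distance (1.3) p. 604 of part I [Balaban1982Higgs1]: **THE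
TORUS ∕ BOX DISTANCE SEAM** (FILE 17 of the Feynman-rule evaluator lineage `B3GraphAmplitude` … `B3Ineq210ZeroHiggsTorus`).  The line bound (2.10), *"|G_k(j)(Ω,B;x,x′)| ≦ O(1)(L^jη)^{−d+2}
e^{−δ₁(L^jη)^{−1}|x−x′|}"*, is printed on the torus `T_η` (`η = L^{−k}`, (1.1) p. 412) with the torus distance (I.1.3) p. 604,
`|x − y| = max_μ min{|x_μ − y_μ|, 2L_μ − |x_μ − y_μ|}` (typer's `HiggsLattice.Site.tdist`, in lattice units), and this is the form in
which the tree PROVES it at zero background (p03 ∕ p20 ∕ p33 ∕ r14; on the (Higgs)₂,₃ carrier FILE 16's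
`B3Ineq210ZeroHiggsTorus.gpieceH_bounds_model`: `… · exp(−δ₁(L^jη)^{−1}(η · tdist x x′))`).  p19's kernel-checked proof of the first
estimate (2.13) ∕ (2.14) (`B3Ineq213Amplitude.Amp`, `B3Ineq213Proof.Amp.ineq213`) reads the positions of (2.13) as LABELS
`ξ ∈ ℕ^d` (η-units) with the sup-distance `B3Ineq213.supDist ξ ξ′ = max_μ |ξ_μ − ξ′_μ|` (its header: *"positions on ηℤ^d_{≥0} in
η-units, sup-norm distances"*), and asks the line kernels to decay in THAT distance (`Amp.K_le`:
`… · exp(−2δ₀(L^tη)^{−1}((L^k)^{−1} · supDist ξ ξ′))`); FILE 12 (`B3GraphAmplitudePositionForm` §8) charts `T_η` by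
`ξ ↦ (ξ_μ mod 2L_μ∕η)_μ` and hands the torus kernels, read at the labels of the blocks of the line's endpoints, to p19 under exactly
that hypothesis.  The two distances differ at the seam of the chart (labels `0` and `2L_μ∕η − 1` are torus neighbours), which FILE 12's and
FILE 16's HONEST SCOPE name and do not repair.  This file supplies the lattice arithmetic that closes the seam where it can be closed:

* §1 ONE COORDINATE: for labels `a, b ∈ ℕ` read in `ℤ∕n`, `min{(a − b) mod n, (b − a) mod n} = min{|a−b| mod n, n − |a−b| mod n}`
  (`circDist_natCast`, the printed `min{|x_μ − y_μ|, 2L_μ − |x_μ − y_μ|}`), hence `≦ |a − b|` ALWAYS (`circDist_natCast_le`) and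
  `= |a − b|` when `2|a − b| ≦ n` — no wrap-around (`circDist_natCast_eq`); translation invariance (`circDist_add_right`).
* §2 THE CHART `labelChart P i ξ = (ξ_μ mod 2L^{K−i}ML′_μ)_μ : T^{(i)}` (FILE 12's `coordChart` is the level-`0` instance, definitionally):
  labels (`val_labelChart`), every site is the chart of an honest label (`exists_label_eq`), injectivity on honest labels
  (`labelChart_injOn`); **`tdist_labelChart_le_supDist`** (the torus distance (I.1.3) of charted labels is AT MOST p19's box distance —
  always; the direction of p14's `B1TorusChainChart.tdist_le_supNorm_fromT` for the B1 chain chart), **`tdist_labelChart_eq_supDist`**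
  (EQUALITY when `2|ξ_μ − ξ′_μ| ≦ 2L^{K−i}ML′_μ` for every `μ`), `tdist_labelChart_eq_supDist_of_lt_half` (labels in the half-torus
  `[0, L^{K−i}ML′_μ)^d` suffice), `tdist_add_right` (the torus distance is translation invariant, so any configuration of small
  diameter can be moved off the seam).
* §3 THE LABELS p19 ∕ FILE 12 READ: the points `pts L ⟨k, z⟩` of p19's unit cube at the block position `z` (`mem_pts_iff_label`:
  `z_μL^k ≦ ξ_μ < (z_μ+1)L^k`), `sitesPerDir_zero_eq_mul` ∕ `halfPerDir_zero_eq_mul` (`2L_μ∕ε = L^k · 2L_μ∕(L^kε)`), hence for blocks in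
  the half-torus `z_μ, z′_μ < L^{K−k}ML′_μ` the labels of their points do not wrap (`label_lt_half_of_mem_pts`) and
  **`tdist_labelChart_eq_supDist_of_blocks`**.
* §4 TRANSFER OF KERNEL BOUNDS: a box-shape bound implies the torus-shape bound at charted labels always
  (`exp_supDist_le_exp_tdist`, `torusBound_of_boxBound`); a torus-shape bound gives the box-shape bound off the seam
  (`boxBound_of_torusBound`); and, in the exact shapes of the tree, **`lineBound_labelChart_of_torusBound`**: a torus bound
  `|G x x′| ≦ C s^a exp(−δ₁ s^{−1}((L^k)^{−1} · tdist x x′))`, `s = L^j(L^k)^{−1}`, on `T_η = T^{(0)}` yields p19's ∕ FILE 12 §8's `K_le`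
  body `|G(chart ξ)(chart ξ′)| ≦ C s^a exp(−2(δ₁∕2)s^{−1}((L^k)^{−1} · supDist ξ ξ′))` for all labels of two blocks in the half-torus
  (`δ₀ = δ₁∕2`, p19's `B3Ineq213Proof.toModel_δ₀`).
* §5 THE SCALE DICTIONARY between p14's level-`k` `Setup` torus and p19's model scales: `(setupAt S k).eps = (L^k)^{−1} = η`
  (`eps_setupAt`), `(setupAt S k).spacing t = L^t(L^k)^{−1}` (`spacing_setupAt`, p19's `B3Ineq215.Model.sc k t` verbatim), and the
  transfer in FILE 16's literal output shape (`lineBound_labelChart_of_torusBound_setupAt`).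
* §6 OFF THE SEAM BY TRANSLATION: the label vector `labelsOf x` of a site (`labelChart_labelsOf`, `labelsOf_labelChart`), and
  **`tdist_eq_supDist_translate`**: two sites within torus distance `D` of a common site `p`, `2D < L^{K−i}ML′_μ`, have torus distance
  EQUAL to the box distance of the labels of their translates by `D − p` (`val_add_sub_le`, `val_translate_lt_half`,
  `tdist_eq_supDist_labelsOf_of_lt_half`) — a configuration of torus diameter below half the half-period never sees the seam.
* §7 (v1.1) THE BASED CHART `labelChartAt P i b ξ = b + labelChart ξ` about ANY base point `b`: reading the kernels and vertex functions of
  `T_η` through a based chart instead of translating them, the (2.13) consumer needs NO translation invariance of the kernels —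
  `labelChartAt_injOn_pts` ∕ `labelChart_injOn_pts` (FILE 12 §7's `hinj` on the points of any block), `tdist_labelChartAt` (= the
  `labelChart` distance, by `tdist_add_right`), `…_le_supDist` ∕ `…_eq_supDist` ∕ `…_of_lt_half` ∕ `…_of_blocks`,
  **`exists_halfLabel_eq_labelChartAt`** (every site within torus distance `D` of `p`, `2D < L^{K−i}ML′_μ`, IS `labelChartAt (p − D)` of an
  honest half-box label), **`lineBound_labelChartAt_of_torusBound`** (+ `_setupAt`): the torus (2.10) shape ⟹ p19's `K_le` body for kernels
  read through any based chart, on blocks in the half-box of labels.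
* §8 (v1.2) BLOCKS ABOUT A BASE BLOCK: the corner `blockCorner c` of a block `c ∈ T^{(k)}` (`val_blockCorner`),
  **`blockIter_sub_blockCorner`** (the block map COMMUTES with block-lattice translations: `(x − corner c)_k = x_k − c`), and — from FILE 12's
  block chart `B^k(y) = chart″pts⟨k, labels y⟩` (`B3GraphAmplitudePositionForm.mem_blockK_iff_exists_coordChart` ∕ `val_blockIter`, of which
  PRIVATE copies are kept here because FILE 12 sits above this file in the import DAG) — **`mem_blockK_iff_exists_labelChartAt`**: `x ∈ B^k(y)` iff `x = labelChartAt (blockCorner c) ξ` for a point `ξ` of p19's cube at the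
  RELATIVE block position `labelsOf (y − c)` — block-localized configurations anywhere on `T_η` get honest label boxes about any base block.
  `relLabels_lt_half_of_tdist_le`: with the base block `c₀ := p − D` every block within torus distance `D` of `p` (`2D < L^{K−k}ML′_μ`) has its
  relative position in the half-box (the `hz` of §7's transfer).

HONEST SCOPE: pure lattice arithmetic; it does not touch which cubes of a graph lie in a half-box (the (2.13) consumer's localization
bookkeeping).  In the owner's (r15) words: the seam FILE 12 ∕ FILE 16 named in their honest scope, closed for half-box labels; which cubes of
a graph sit in a half-box stays the (2.13) consumer's localization bookkeeping.  Kernel-agnostic; nothing of the paper is asserted; §6 moves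
the SITES of a small configuration off the seam and the translation invariance of the KERNELS is not touched — nor is it NEEDED (v1.1, §7):
the (2.13) consumer reads the kernels and vertex functions through the based chart `labelChartAt b` for a base point `b` chosen from the
configuration (e.g. `b = p − D` of `exists_halfLabel_eq_labelChartAt`), and the torus-shape line bounds transfer verbatim for EVERY `b`
(`lineBound_labelChartAt_of_torusBound`); no behaviour of any kernel under translations is used anywhere in this file.  What remains outside:
a localized graph whose cubes `□(v)` spread over more than half a half-period of `T_η` is outside p19's box reading of (2.13) and stays
outside after this file — the torus version of the tree length `d({□(v)})` is r15's ∕ p19's call.  Print works on the torus throughout; the box reading and hence this seam are OURS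
(p19's header: *"Reading choices"*).  FILE 12 (`B3GraphAmplitudePositionForm`, p378154) is in the tree; it is deliberately NOT imported
(its `coordChart P` is `labelChart P 0` by `rfl`, for the consumer to use), so that this file depends on built modules only.

statement-level skeleton of published theorems with citation tags; proofs where landed; nothing here is a claim about the Yang–Mills
mass gap.

References: [Balaban1983Higgs3] T. Bałaban, CMP 88 (1983) 411–445, (1.1) p. 412, (2.10) ∕ (2.13) p. 426; [Balaban1982Higgs1]
T. Bałaban, CMP 85 (1982) 603–636, (1.2) ∕ (1.3) p. 604, (1.19) ∕ (1.20) p. 607.  Unit `lit-balaban-p26` gen 45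
(literature-prover-lit-balaban-p26-g45-0).  v1.0 p381901 ✓ a130e66586b6 (§§1–6); v1.1 p382732 ✓ f9a15e12e624 (+ §7); v1.2 (this text) = v1.1
verbatim + §8, append-only.
-/

open Finset

namespace Literature.MathematicalPhysics.QuantumFieldTheory.Balaban1983to89.B3Eq213TorusBoxSeam

open Literature.MathematicalPhysics.QuantumFieldTheory.Balaban1983to89.B1Eq211ZeroFieldTorus (Shape)
open Literature.MathematicalPhysics.QuantumFieldTheory.Balaban1983to89.B1Eq211ZeroFieldTorusLevels (setupAt)
open B3Ineq215 (Cube)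
open B3Ineq213 (supDist pts)

/-! ## §1 One coordinate: the circular distance of two labels read modulo `n` -/

section OneCoordinate

variable (n : ℕ) [NeZero n]

omit [NeZero n] in
/-- kernel: `((a − b) mod n)` for `b ≦ a`. [cite: Balaban1982Higgs1, (1.3) p.604] -/
theorem val_natCast_sub_natCast {a b : ℕ} (h : b ≤ a) : (((a : ℕ) : ZMod n) - ((b : ℕ) : ZMod n)).val = (a - b) % n := by
  rw [← Nat.cast_sub h, ZMod.val_natCast]

/-- kernel: `((b − a) mod n) = n − ((a − b) mod n)` for `b ≦ a` off the diagonal, `0` on it. [cite: Balaban1982Higgs1, (1.3) p.604] -/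
theorem val_natCast_sub_natCast' {a b : ℕ} (h : b ≤ a) :
    (((b : ℕ) : ZMod n) - ((a : ℕ) : ZMod n)).val = if (a - b) % n = 0 then 0 else n - (a - b) % n := by
  rw [← neg_sub, ZMod.neg_val, val_natCast_sub_natCast n h]
  by_cases h0 : (a - b) % n = 0
  · have hz : ((a : ℕ) : ZMod n) - ((b : ℕ) : ZMod n) = 0 := by
      rw [← ZMod.val_eq_zero, val_natCast_sub_natCast n h, h0]
    rw [if_pos hz, if_pos h0]
  · have hz : ((a : ℕ) : ZMod n) - ((b : ℕ) : ZMod n) ≠ 0 := by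
      rw [Ne, ← ZMod.val_eq_zero, val_natCast_sub_natCast n h]
      exact h0
    rw [if_neg hz, if_neg h0]

/-- **One coordinate of (I.1.3) for charted labels**: `min{(a − b) mod n, (b − a) mod n} = min{|a − b| mod n, n − (|a − b| mod n)}` — the
printed *"min{|x_μ − y_μ|, 2L_μ − |x_μ − y_μ|}"* for labels `a, b < n = 2L_μ∕η`. [cite: Balaban1982Higgs1, (1.3) p.604] -/
theorem circDist_natCast (a b : ℕ) :
    min (((a : ℕ) : ZMod n) - ((b : ℕ) : ZMod n)).val (((b : ℕ) : ZMod n) - ((a : ℕ) : ZMod n)).val =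
      min (Nat.dist a b % n) (n - Nat.dist a b % n) := by
  -- the two sides are symmetric in `a, b`; reduce to `b ≦ a`
  wlog h : b ≤ a generalizing a b
  · rw [min_comm, Nat.dist_comm]
    exact this b a (le_of_lt (not_le.mp h))
  rw [Nat.dist_eq_sub_of_le_right h, val_natCast_sub_natCast n h, val_natCast_sub_natCast' n h]
  by_cases h0 : (a - b) % n = 0
  · rw [if_pos h0, h0]
    simp
  · rw [if_neg h0]

/-- **The circular distance of charted labels is at most the label distance** — always (`|a−b| mod n ≦ |a−b|`).
[cite: Balaban1982Higgs1, (1.3) p.604] -/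
theorem circDist_natCast_le (a b : ℕ) :
    min (((a : ℕ) : ZMod n) - ((b : ℕ) : ZMod n)).val (((b : ℕ) : ZMod n) - ((a : ℕ) : ZMod n)).val ≤ Nat.dist a b := by
  rw [circDist_natCast]
  exact (min_le_left _ _).trans (Nat.mod_le _ _)

/-- **… and EQUALS it when there is no wrap-around**: `2|a − b| ≦ n` ⟹ `min{…} = |a − b|`. [cite: Balaban1982Higgs1, (1.3) p.604] -/
theorem circDist_natCast_eq {a b : ℕ} (h : 2 * Nat.dist a b ≤ n) :
    min (((a : ℕ) : ZMod n) - ((b : ℕ) : ZMod n)).val (((b : ℕ) : ZMod n) - ((a : ℕ) : ZMod n)).val = Nat.dist a b := by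
  rw [circDist_natCast]
  have hn : 0 < n := Nat.pos_of_ne_zero (NeZero.ne n)
  have hlt : Nat.dist a b < n := by omega
  rw [Nat.mod_eq_of_lt hlt]
  exact min_eq_left (by omega)

omit [NeZero n] in
/-- The circular distance is translation invariant. [cite: Balaban1982Higgs1, (1.3) p.604] -/
theorem circDist_add_right (u v c : ZMod n) :
    min (u + c - (v + c)).val (v + c - (u + c)).val = min (u - v).val (v - u).val := by
  rw [add_sub_add_right_eq_sub, add_sub_add_right_eq_sub]

end OneCoordinate

/-! ## §2 The label chart of the torus `T^{(i)}` and the torus distance (I.1.3) of charted labels -/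

section Chart

variable (P : HiggsLattice.Params) (i : ℕ)

/-- **The label chart** `ℕ^d → T^{(i)}_{L^iε}`: `ξ ↦ (ξ_μ mod 2L^{K−i}ML′_μ)_μ` (FILE 12's `coordChart` is the instance `i = 0`).
[cite: Balaban1982Higgs1, (1.2) p.604] -/
def labelChart (ξ : Fin P.d → ℕ) : HiggsLattice.Site P i := fun μ => ((ξ μ : ℕ) : ZMod (P.sitesPerDir i μ))

/-- Unfolding of the chart. [cite: Balaban1982Higgs1, (1.2) p.604] -/
theorem labelChart_apply (ξ : Fin P.d → ℕ) (μ : Fin P.d) : labelChart P i ξ μ = ((ξ μ : ℕ) : ZMod (P.sitesPerDir i μ)) := rfl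

variable {P i}

/-- Honest labels are preserved: `(ξ_μ mod n_μ) = ξ_μ` for `ξ_μ < n_μ`. [cite: Balaban1982Higgs1, (1.2) p.604] -/
theorem val_labelChart {ξ : Fin P.d → ℕ} {μ : Fin P.d} (h : ξ μ < P.sitesPerDir i μ) : (labelChart P i ξ μ).val = ξ μ := by
  rw [labelChart_apply, ZMod.val_natCast, Nat.mod_eq_of_lt h]

/-- Every site is the chart of an honest label (its own labels). [cite: Balaban1982Higgs1, (1.2) p.604] -/
theorem exists_label_eq (x : HiggsLattice.Site P i) :
    ∃ ξ : Fin P.d → ℕ, (∀ μ, ξ μ < P.sitesPerDir i μ) ∧ labelChart P i ξ = x :=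
  ⟨fun μ => (x μ).val, fun μ => ZMod.val_lt (x μ), funext fun μ => by rw [labelChart_apply, ZMod.natCast_zmod_val]⟩

/-- The chart is injective on honest labels. [cite: Balaban1982Higgs1, (1.2) p.604] -/
theorem labelChart_injOn : Set.InjOn (labelChart P i) {ξ | ∀ μ, ξ μ < P.sitesPerDir i μ} := by
  intro ξ hξ ξ' hξ' h
  funext μ
  have hμ := congrArg (fun x : HiggsLattice.Site P i => (x μ).val) h
  simpa only [val_labelChart (hξ μ), val_labelChart (hξ' μ)] using hμ

/-- **(I.1.3) of charted labels, coordinatewise**: `tdist (chart ξ) (chart ξ′) = max_μ min{|ξ_μ−ξ′_μ| mod n_μ, n_μ − (|ξ_μ−ξ′_μ| mod n_μ)}`,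
`n_μ = 2L^{K−i}ML′_μ`. [cite: Balaban1982Higgs1, (1.3) p.604] -/
theorem tdist_labelChart (ξ ξ' : Fin P.d → ℕ) :
    HiggsLattice.Site.tdist (labelChart P i ξ) (labelChart P i ξ') =
      univ.sup fun μ => min (Nat.dist (ξ μ) (ξ' μ) % P.sitesPerDir i μ)
        (P.sitesPerDir i μ - Nat.dist (ξ μ) (ξ' μ) % P.sitesPerDir i μ) := by
  unfold HiggsLattice.Site.tdist
  congr 1
  funext μ
  exact circDist_natCast (P.sitesPerDir i μ) (ξ μ) (ξ' μ)

/-- **THE TORUS DISTANCE OF CHARTED LABELS IS AT MOST THE BOX DISTANCE** — always: `tdist (chart ξ) (chart ξ′) ≦ supDist ξ ξ′`.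
[cite: Balaban1982Higgs1, (1.3) p.604] [cite: Balaban1983Higgs3, (2.10) p.426] -/
theorem tdist_labelChart_le_supDist (ξ ξ' : Fin P.d → ℕ) :
    HiggsLattice.Site.tdist (labelChart P i ξ) (labelChart P i ξ') ≤ supDist ξ ξ' := by
  unfold HiggsLattice.Site.tdist supDist
  exact Finset.sup_mono_fun fun μ _ => circDist_natCast_le (P.sitesPerDir i μ) (ξ μ) (ξ' μ)

/-- **… AND EQUALS IT OFF THE SEAM**: if `2|ξ_μ − ξ′_μ| ≦ 2L^{K−i}ML′_μ` for every `μ` (no wrap-around), then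
`tdist (chart ξ) (chart ξ′) = supDist ξ ξ′`. [cite: Balaban1982Higgs1, (1.3) p.604] [cite: Balaban1983Higgs3, (2.10) p.426] -/
theorem tdist_labelChart_eq_supDist {ξ ξ' : Fin P.d → ℕ} (hnw : ∀ μ, 2 * Nat.dist (ξ μ) (ξ' μ) ≤ P.sitesPerDir i μ) :
    HiggsLattice.Site.tdist (labelChart P i ξ) (labelChart P i ξ') = supDist ξ ξ' := by
  unfold HiggsLattice.Site.tdist supDist
  congr 1
  funext μ
  exact circDist_natCast_eq (P.sitesPerDir i μ) (hnw μ)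

/-- Labels in the half-torus `[0, L^{K−i}ML′_μ)` do not wrap. [cite: Balaban1982Higgs1, (1.2) p.604] -/
theorem noWrap_of_lt_half {ξ ξ' : Fin P.d → ℕ} (hξ : ∀ μ, ξ μ < P.halfPerDir i μ) (hξ' : ∀ μ, ξ' μ < P.halfPerDir i μ)
    (μ : Fin P.d) : 2 * Nat.dist (ξ μ) (ξ' μ) ≤ P.sitesPerDir i μ := by
  rw [HiggsLattice.Params.sitesPerDir_eq]
  have h1 := hξ μ
  have h2 := hξ' μ
  unfold Nat.dist
  omega

/-- For labels in the half-torus the torus distance IS the box distance. [cite: Balaban1982Higgs1, (1.3) p.604]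
[cite: Balaban1983Higgs3, (2.10) p.426] -/
theorem tdist_labelChart_eq_supDist_of_lt_half {ξ ξ' : Fin P.d → ℕ} (hξ : ∀ μ, ξ μ < P.halfPerDir i μ)
    (hξ' : ∀ μ, ξ' μ < P.halfPerDir i μ) :
    HiggsLattice.Site.tdist (labelChart P i ξ) (labelChart P i ξ') = supDist ξ ξ' :=
  tdist_labelChart_eq_supDist (noWrap_of_lt_half hξ hξ')

/-- **The torus distance (I.1.3) is translation invariant** (so a configuration of small diameter can be translated off the seam).
[cite: Balaban1982Higgs1, (1.3) p.604] -/
theorem tdist_add_right (x y c : HiggsLattice.Site P i) :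
    HiggsLattice.Site.tdist (fun μ => x μ + c μ) (fun μ => y μ + c μ) = HiggsLattice.Site.tdist x y := by
  unfold HiggsLattice.Site.tdist
  congr 1
  funext μ
  exact circDist_add_right (P.sitesPerDir i μ) (x μ) (y μ) (c μ)

end Chart

/-! ## §3 The labels p19 ∕ FILE 12 read: points of unit cubes at block positions, and blocks in the half-torus -/

section Blocks

/-- **The lattice points of p19's cube `⟨k, z⟩`** (side `L^k`, position `z`): `z_μ L^k ≦ ξ_μ < (z_μ + 1) L^k` (FILE 12's `mem_pts_boxOf`
for `z = boxOf y`). [cite: Balaban1983Higgs3, (2.13) p.426] -/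
theorem mem_pts_iff_label {d L : ℕ} (hL : 0 < L) (k : ℕ) (z ξ : Fin d → ℕ) :
    ξ ∈ pts L (⟨k, z⟩ : Cube d) ↔ ∀ μ, z μ * L ^ k ≤ ξ μ ∧ ξ μ < (z μ + 1) * L ^ k := by
  rw [B3Ineq213.mem_pts_iff hL]
  simp only [B3Ineq215.Cube.desc, B3Ineq213.pt, Nat.sub_zero, Finset.mem_image, Fintype.mem_piFinset, Finset.mem_Ico,
    B3Ineq215.Cube.mk.injEq, true_and, exists_eq_right]

variable {P : HiggsLattice.Params} {k : ℕ}

/-- `2L_μ∕ε = L^k · 2L_μ∕(L^kε)`: the fine torus has `L^k` times the sites of `T^{(k)}` per direction (`k ≦ K`).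
[cite: Balaban1982Higgs1, (1.20) p.607] -/
theorem sitesPerDir_zero_eq_mul (hk : k ≤ P.K) (μ : Fin P.d) : P.sitesPerDir 0 μ = P.L ^ k * P.sitesPerDir k μ := by
  have h : P.L ^ P.K = P.L ^ k * P.L ^ (P.K - k) := by rw [← pow_add, Nat.add_sub_cancel' hk]
  show 2 * (P.L ^ (P.K - 0) * P.M * P.Lp μ) = P.L ^ k * (2 * (P.L ^ (P.K - k) * P.M * P.Lp μ))
  rw [Nat.sub_zero, h]
  ring

/-- `L_μ∕ε = L^k · L_μ∕(L^kε)` (half-periods, `k ≦ K`). [cite: Balaban1982Higgs1, (1.2) p.604] -/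
theorem halfPerDir_zero_eq_mul (hk : k ≤ P.K) (μ : Fin P.d) : P.halfPerDir 0 μ = P.L ^ k * P.halfPerDir k μ := by
  have h : P.L ^ P.K = P.L ^ k * P.L ^ (P.K - k) := by rw [← pow_add, Nat.add_sub_cancel' hk]
  show P.L ^ (P.K - 0) * P.M * P.Lp μ = P.L ^ k * (P.L ^ (P.K - k) * P.M * P.Lp μ)
  rw [Nat.sub_zero, h]
  ring

/-- **Points of a block in the half-torus are labels in the half-torus of `T_ε`**: `z_μ < L^{K−k}ML′_μ`, `ξ ∈ pts ⟨k, z⟩` ⟹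
`ξ_μ < L^K M L′_μ = L_μ∕ε`. [cite: Balaban1982Higgs1, (1.2) p.604] [cite: Balaban1983Higgs3, (2.13) p.426] -/
theorem label_lt_half_of_mem_pts (hk : k ≤ P.K) {z : Fin P.d → ℕ} (hz : ∀ μ, z μ < P.halfPerDir k μ) {ξ : Fin P.d → ℕ}
    (hξ : ξ ∈ pts P.L (⟨k, z⟩ : Cube P.d)) (μ : Fin P.d) : ξ μ < P.halfPerDir 0 μ := by
  have h := ((mem_pts_iff_label P.hL k z ξ).1 hξ μ).2
  rw [halfPerDir_zero_eq_mul hk]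
  calc ξ μ < (z μ + 1) * P.L ^ k := h
    _ ≤ P.halfPerDir k μ * P.L ^ k := Nat.mul_le_mul_right _ (hz μ)
    _ = P.L ^ k * P.halfPerDir k μ := mul_comm _ _

/-- Points of a block are honest labels of `T_ε` (`ξ_μ < 2L_μ∕ε`; FILE 12's `lt_sitesPerDir_of_mem_pts` for `z = boxOf y`).
[cite: Balaban1982Higgs1, (1.2) p.604] -/
theorem label_lt_sitesPerDir_of_mem_pts (hk : k ≤ P.K) {z : Fin P.d → ℕ} (hz : ∀ μ, z μ < P.sitesPerDir k μ) {ξ : Fin P.d → ℕ}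
    (hξ : ξ ∈ pts P.L (⟨k, z⟩ : Cube P.d)) (μ : Fin P.d) : ξ μ < P.sitesPerDir 0 μ := by
  have h := ((mem_pts_iff_label P.hL k z ξ).1 hξ μ).2
  rw [sitesPerDir_zero_eq_mul hk]
  calc ξ μ < (z μ + 1) * P.L ^ k := h
    _ ≤ P.sitesPerDir k μ * P.L ^ k := Nat.mul_le_mul_right _ (hz μ)
    _ = P.L ^ k * P.sitesPerDir k μ := mul_comm _ _

/-- **OFF THE SEAM, BLOCKWISE**: for two blocks in the half-torus (`z_μ, z′_μ < L^{K−k}ML′_μ`) the torus distance (I.1.3) of any two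
of their charted points IS p19's box distance of the labels. [cite: Balaban1982Higgs1, (1.3) p.604] [cite: Balaban1983Higgs3, (2.13) p.426] -/
theorem tdist_labelChart_eq_supDist_of_blocks (hk : k ≤ P.K) {z z' : Fin P.d → ℕ} (hz : ∀ μ, z μ < P.halfPerDir k μ)
    (hz' : ∀ μ, z' μ < P.halfPerDir k μ) {ξ ξ' : Fin P.d → ℕ} (hξ : ξ ∈ pts P.L (⟨k, z⟩ : Cube P.d))
    (hξ' : ξ' ∈ pts P.L (⟨k, z'⟩ : Cube P.d)) :
    HiggsLattice.Site.tdist (labelChart P 0 ξ) (labelChart P 0 ξ') = supDist ξ ξ' :=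
  tdist_labelChart_eq_supDist_of_lt_half (label_lt_half_of_mem_pts hk hz hξ) (label_lt_half_of_mem_pts hk hz' hξ')

end Blocks

/-! ## §4 Transfer of kernel bounds across the seam -/

section Transfer

variable {P : HiggsLattice.Params} {i : ℕ}

/-- A box-shape exponential is dominated by the torus-shape one at charted labels — always (`tdist ≦ supDist`).
[cite: Balaban1983Higgs3, (2.10) p.426] -/
theorem exp_supDist_le_exp_tdist {c : ℝ} (hc : 0 ≤ c) (ξ ξ' : Fin P.d → ℕ) :
    Real.exp (-(c * (supDist ξ ξ' : ℝ))) ≤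
      Real.exp (-(c * (HiggsLattice.Site.tdist (labelChart P i ξ) (labelChart P i ξ') : ℝ))) :=
  Real.exp_le_exp.2 (neg_le_neg (mul_le_mul_of_nonneg_left (Nat.cast_le.2 (tdist_labelChart_le_supDist ξ ξ')) hc))

/-- **BOX BOUND ⟹ TORUS BOUND** (always): a quantity bounded by `B·exp(−c·supDist ξ ξ′)` (`B, c ≧ 0`) is bounded by
`B·exp(−c·tdist (chart ξ) (chart ξ′))`. [cite: Balaban1983Higgs3, (2.10) p.426] -/
theorem torusBound_of_boxBound {v B c : ℝ} (hB : 0 ≤ B) (hc : 0 ≤ c) {ξ ξ' : Fin P.d → ℕ}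
    (h : v ≤ B * Real.exp (-(c * (supDist ξ ξ' : ℝ)))) :
    v ≤ B * Real.exp (-(c * (HiggsLattice.Site.tdist (labelChart P i ξ) (labelChart P i ξ') : ℝ))) :=
  h.trans (mul_le_mul_of_nonneg_left (exp_supDist_le_exp_tdist hc ξ ξ') hB)

/-- **TORUS BOUND ⟹ BOX BOUND OFF THE SEAM**: with no wrap-around a bound `B·exp(−c(η·tdist (chart ξ) (chart ξ′)))` IS the bound
`B·exp(−c(η·supDist ξ ξ′))`. [cite: Balaban1983Higgs3, (2.10) p.426] -/
theorem boxBound_of_torusBound {ξ ξ' : Fin P.d → ℕ} (hnw : ∀ μ, 2 * Nat.dist (ξ μ) (ξ' μ) ≤ P.sitesPerDir i μ) {v B c η : ℝ}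
    (h : v ≤ B * Real.exp (-(c * (η * (HiggsLattice.Site.tdist (labelChart P i ξ) (labelChart P i ξ') : ℝ))))) :
    v ≤ B * Real.exp (-(c * (η * (supDist ξ ξ' : ℝ)))) := by
  rwa [tdist_labelChart_eq_supDist hnw] at h

variable {k : ℕ}

/-- **THE LINE BOUND (2.10) ACROSS THE SEAM, IN THE TREE'S SHAPES**: a torus bound
`|G x x′| ≦ C s^a exp(−δ₁ s^{−1}((L^k)^{−1}·tdist x x′))`, `s = L^j(L^k)^{−1} = L^jη`, on `T_η = T^{(0)}` (FILE 16's `gpieceH_bounds_model`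
after §5's dictionary; r14 ∕ p33 likewise) yields, for all points of two blocks in the half-torus, the body of p19's `Amp.K_le` ∕ FILE 12
§8's hypothesis `K_le` with `δ₀ = δ₁∕2`: `|G(chart ξ)(chart ξ′)| ≦ C s^a exp(−2δ₀ s^{−1}((L^k)^{−1}·supDist ξ ξ′))`.
[cite: Balaban1983Higgs3, (2.10) p.426] [cite: Balaban1983Higgs3, (2.13) p.426] -/
theorem lineBound_labelChart_of_torusBound (hk : k ≤ P.K) {G : HiggsLattice.Site P 0 → HiggsLattice.Site P 0 → ℝ}
    {C a δ₁ : ℝ} {j : ℕ}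
    (hG : ∀ x x', |G x x'| ≤ C * ((P.L : ℝ) ^ j * ((P.L : ℝ) ^ k)⁻¹) ^ a *
      Real.exp (-(δ₁ * ((P.L : ℝ) ^ j * ((P.L : ℝ) ^ k)⁻¹)⁻¹ *
        (((P.L : ℝ) ^ k)⁻¹ * (HiggsLattice.Site.tdist x x' : ℝ)))))
    {z z' : Fin P.d → ℕ} (hz : ∀ μ, z μ < P.halfPerDir k μ) (hz' : ∀ μ, z' μ < P.halfPerDir k μ) :
    ∀ ξ ∈ pts P.L (⟨k, z⟩ : Cube P.d), ∀ ξ' ∈ pts P.L (⟨k, z'⟩ : Cube P.d),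
      |G (labelChart P 0 ξ) (labelChart P 0 ξ')| ≤ C * ((P.L : ℝ) ^ j * ((P.L : ℝ) ^ k)⁻¹) ^ a *
        Real.exp (-(2 * (δ₁ / 2) / ((P.L : ℝ) ^ j * ((P.L : ℝ) ^ k)⁻¹) *
          (((P.L : ℝ) ^ k)⁻¹ * (supDist ξ ξ' : ℝ)))) := by
  intro ξ hξ ξ' hξ'
  have h := hG (labelChart P 0 ξ) (labelChart P 0 ξ')
  rw [tdist_labelChart_eq_supDist_of_blocks hk hz hz' hξ hξ'] at h
  have e : 2 * (δ₁ / 2) / ((P.L : ℝ) ^ j * ((P.L : ℝ) ^ k)⁻¹) = δ₁ * ((P.L : ℝ) ^ j * ((P.L : ℝ) ^ k)⁻¹)⁻¹ := by ring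
  rw [e]
  exact h

end Transfer

/-! ## §5 The scale dictionary: p14's level-`k` `Setup` torus versus p19's model scales -/

section Dictionary

variable {P : HiggsLattice.Params} (S : Shape P) (k : ℕ)

/-- **`η = L^{−k}`**: the fine spacing of the level-`k` `Setup` torus is `(L^k)^{−1}` (III (1.1); p19's `Amp.η`).
[cite: Balaban1983Higgs3, (1.1) p.412] -/
theorem eps_setupAt : (setupAt S k).eps = ((P.L : ℝ) ^ k)⁻¹ := by
  show ((P.L : ℝ)⁻¹) ^ k = ((P.L : ℝ) ^ k)⁻¹
  exact inv_pow _ _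

/-- **`L^tη = L^t(L^k)^{−1}`**: the spacings of the level-`k` `Setup` torus are p19's `B3Ineq215.Model.sc k t` verbatim.
[cite: Balaban1983Higgs3, (2.6) p.424] -/
theorem spacing_setupAt (t : ℕ) : (setupAt S k).spacing t = (P.L : ℝ) ^ t * ((P.L : ℝ) ^ k)⁻¹ := by
  show (P.L : ℝ) ^ t * ((P.L : ℝ)⁻¹) ^ k = (P.L : ℝ) ^ t * ((P.L : ℝ) ^ k)⁻¹
  rw [inv_pow]

variable {S k}

/-- **FILE 16's output shape across the seam**: a torus bound stated with `(setupAt S k).spacing j` and `(setupAt S k).eps` (the literal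
shape of `B3Ineq210ZeroHiggsTorus.gpieceH_bounds_model` ∕ `gpieceH_mixed_bound_model`) yields p19's ∕ FILE 12 §8's `K_le` body on the
points of two blocks in the half-torus. [cite: Balaban1983Higgs3, (2.10) p.426] [cite: Balaban1983Higgs3, (2.13) p.426] -/
theorem lineBound_labelChart_of_torusBound_setupAt (hk : k ≤ P.K) {G : HiggsLattice.Site P 0 → HiggsLattice.Site P 0 → ℝ}
    {C a δ₁ : ℝ} {j : ℕ}
    (hG : ∀ x x', |G x x'| ≤ C * (setupAt S k).spacing j ^ a *
      Real.exp (-(δ₁ * ((setupAt S k).spacing j)⁻¹ * ((setupAt S k).eps * (HiggsLattice.Site.tdist x x' : ℝ)))))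
    {z z' : Fin P.d → ℕ} (hz : ∀ μ, z μ < P.halfPerDir k μ) (hz' : ∀ μ, z' μ < P.halfPerDir k μ) :
    ∀ ξ ∈ pts P.L (⟨k, z⟩ : Cube P.d), ∀ ξ' ∈ pts P.L (⟨k, z'⟩ : Cube P.d),
      |G (labelChart P 0 ξ) (labelChart P 0 ξ')| ≤ C * ((P.L : ℝ) ^ j * ((P.L : ℝ) ^ k)⁻¹) ^ a *
        Real.exp (-(2 * (δ₁ / 2) / ((P.L : ℝ) ^ j * ((P.L : ℝ) ^ k)⁻¹) *
          (((P.L : ℝ) ^ k)⁻¹ * (supDist ξ ξ' : ℝ)))) := by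
  rw [spacing_setupAt, eps_setupAt] at hG
  exact lineBound_labelChart_of_torusBound hk hG hz hz'

end Dictionary

/-! ## §6 Moving a configuration of small torus diameter off the seam -/

section OffSeam

/-- kernel, one coordinate: translating by `D − p` puts every residue within circular distance `D` of `p` into the labels `[0, 2D]`
(`2D < n`). [cite: Balaban1982Higgs1, (1.3) p.604] -/
theorem val_add_sub_le (n : ℕ) [NeZero n] {u p : ZMod n} {D : ℕ} (h : min (u - p).val (p - u).val ≤ D) (hD : 2 * D < n) :
    (u + (((D : ℕ) : ZMod n) - p)).val ≤ 2 * D := by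
  have hDval : ((D : ℕ) : ZMod n).val = D := ZMod.val_natCast_of_lt (by omega)
  rcases min_le_iff.1 h with h1 | h1
  · have e : u + (((D : ℕ) : ZMod n) - p) = ((D : ℕ) : ZMod n) + (u - p) := by ring
    have hlt : ((D : ℕ) : ZMod n).val + (u - p).val < n := by rw [hDval]; omega
    rw [e, ZMod.val_add_of_lt hlt, hDval]
    omega
  · have e : u + (((D : ℕ) : ZMod n) - p) = ((D : ℕ) : ZMod n) - (p - u) := by ring
    rw [e, ZMod.val_sub (by rw [hDval]; exact h1), hDval]
    omega

variable {P : HiggsLattice.Params} {i : ℕ}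

/-- The label vector `((x_μ).val)_μ ∈ ℕ^d` of a site (FILE 12's `boxOf` at level `k`). [cite: Balaban1982Higgs1, (1.2) p.604] -/
def labelsOf (x : HiggsLattice.Site P i) : Fin P.d → ℕ := fun μ => (x μ).val

/-- Unfolding of `labelsOf`. [cite: Balaban1982Higgs1, (1.2) p.604] -/
theorem labelsOf_apply (x : HiggsLattice.Site P i) (μ : Fin P.d) : labelsOf x μ = (x μ).val := rfl

/-- Labels are honest. [cite: Balaban1982Higgs1, (1.2) p.604] -/
theorem labelsOf_lt (x : HiggsLattice.Site P i) (μ : Fin P.d) : labelsOf x μ < P.sitesPerDir i μ := ZMod.val_lt (x μ)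

/-- A site is the chart of its labels. [cite: Balaban1982Higgs1, (1.2) p.604] -/
theorem labelChart_labelsOf (x : HiggsLattice.Site P i) : labelChart P i (labelsOf x) = x :=
  funext fun μ => by rw [labelChart_apply, labelsOf_apply, ZMod.natCast_zmod_val]

/-- Honest labels are the labels of their chart. [cite: Balaban1982Higgs1, (1.2) p.604] -/
theorem labelsOf_labelChart {ξ : Fin P.d → ℕ} (h : ∀ μ, ξ μ < P.sitesPerDir i μ) : labelsOf (labelChart P i ξ) = ξ :=
  funext fun μ => by rw [labelsOf_apply, val_labelChart (h μ)]

/-- For two sites in the half-torus the torus distance is the box distance of their labels. [cite: Balaban1982Higgs1, (1.3) p.604] -/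
theorem tdist_eq_supDist_labelsOf_of_lt_half {x y : HiggsLattice.Site P i} (hx : ∀ μ, (x μ).val < P.halfPerDir i μ)
    (hy : ∀ μ, (y μ).val < P.halfPerDir i μ) : HiggsLattice.Site.tdist x y = supDist (labelsOf x) (labelsOf y) := by
  have h := tdist_labelChart_eq_supDist_of_lt_half (P := P) (i := i) (ξ := labelsOf x) (ξ' := labelsOf y) hx hy
  rwa [labelChart_labelsOf, labelChart_labelsOf] at h

/-- Each coordinate's circular distance is at most the torus distance (the `max_μ` of (I.1.3)). [cite: Balaban1982Higgs1, (1.3) p.604] -/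
theorem circDist_le_tdist (x y : HiggsLattice.Site P i) (μ : Fin P.d) :
    min (x μ - y μ).val (y μ - x μ).val ≤ HiggsLattice.Site.tdist x y :=
  Finset.le_sup (f := fun μ : Fin P.d => min (x μ - y μ).val (y μ - x μ).val) (Finset.mem_univ μ)

/-- **Translating by `D − p` puts the torus ball of radius `D` about `p` into the half-torus** (`2D < L^{K−i}ML′_μ`).
[cite: Balaban1982Higgs1, (1.3) p.604] -/
theorem val_translate_lt_half {x p : HiggsLattice.Site P i} {D : ℕ} (h : HiggsLattice.Site.tdist x p ≤ D)
    (hD : ∀ μ, 2 * D < P.halfPerDir i μ) (μ : Fin P.d) :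
    (x μ + (((D : ℕ) : ZMod (P.sitesPerDir i μ)) - p μ)).val < P.halfPerDir i μ := by
  have h1 : min (x μ - p μ).val (p μ - x μ).val ≤ D := (circDist_le_tdist x p μ).trans h
  have h2 := hD μ
  have hn : 2 * D < P.sitesPerDir i μ := by rw [HiggsLattice.Params.sitesPerDir_eq]; omega
  have h3 := val_add_sub_le (P.sitesPerDir i μ) h1 hn
  omega

/-- **THE SEAM CAN BE AVOIDED FOR CONFIGURATIONS OF SMALL TORUS DIAMETER**: if `x` and `y` lie within torus distance `D` of a site `p` and
`2D < L^{K−i}ML′_μ` for every `μ`, then their torus distance (I.1.3) IS p19's box distance of the labels of their translates by `D − p`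
(translation invariance + the half-torus case). [cite: Balaban1982Higgs1, (1.3) p.604] [cite: Balaban1983Higgs3, (2.13) p.426] -/
theorem tdist_eq_supDist_translate {x y p : HiggsLattice.Site P i} {D : ℕ} (hx : HiggsLattice.Site.tdist x p ≤ D)
    (hy : HiggsLattice.Site.tdist y p ≤ D) (hD : ∀ μ, 2 * D < P.halfPerDir i μ) :
    HiggsLattice.Site.tdist x y =
      supDist (labelsOf (P := P) (i := i) fun μ => x μ + (((D : ℕ) : ZMod (P.sitesPerDir i μ)) - p μ))
        (labelsOf (P := P) (i := i) fun μ => y μ + (((D : ℕ) : ZMod (P.sitesPerDir i μ)) - p μ)) := by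
  rw [← tdist_add_right x y (fun μ => ((D : ℕ) : ZMod (P.sitesPerDir i μ)) - p μ)]
  exact tdist_eq_supDist_labelsOf_of_lt_half (val_translate_lt_half hx hD) (val_translate_lt_half hy hD)

end OffSeam


/-! ## §7 The chart about an arbitrary base point (no kernel invariance needed: read the torus objects through a translated chart) -/

section BasedChart

variable (P : HiggsLattice.Params) (i : ℕ)

/-- **The label chart about a base point `b ∈ T^{(i)}`**: `ξ ↦ b + (ξ_μ mod 2L^{K−i}ML′_μ)_μ` (`labelChart` is the case `b = 0`).  Reading
kernels and vertex functions of `T_η` through `labelChartAt b` instead of translating them: the (2.13) consumer charts the torus about any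
point, so a configuration of small torus diameter ANYWHERE on `T_η` gets honest half-box labels (`exists_halfLabel_eq_labelChartAt`) and the
torus-shape line bounds transfer verbatim (`lineBound_labelChartAt_of_torusBound`). [cite: Balaban1982Higgs1, (1.2) p.604]
[cite: Balaban1983Higgs3, (2.13) p.426] -/
def labelChartAt (b : HiggsLattice.Site P i) (ξ : Fin P.d → ℕ) : HiggsLattice.Site P i := fun μ => labelChart P i ξ μ + b μ

variable {P i}

/-- Unfolding of the based chart. [cite: Balaban1982Higgs1, (1.2) p.604] -/
theorem labelChartAt_apply (b : HiggsLattice.Site P i) (ξ : Fin P.d → ℕ) (μ : Fin P.d) :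
    labelChartAt P i b ξ μ = ((ξ μ : ℕ) : ZMod (P.sitesPerDir i μ)) + b μ := rfl

/-- The based chart about the origin is the label chart. [cite: Balaban1982Higgs1, (1.2) p.604] -/
theorem labelChartAt_zero (ξ : Fin P.d → ℕ) :
    labelChartAt P i (fun μ => (0 : ZMod (P.sitesPerDir i μ))) ξ = labelChart P i ξ :=
  funext fun _ => add_zero _

/-- The based chart is injective on honest labels. [cite: Balaban1982Higgs1, (1.2) p.604] -/
theorem labelChartAt_injOn (b : HiggsLattice.Site P i) : Set.InjOn (labelChartAt P i b) {ξ | ∀ μ, ξ μ < P.sitesPerDir i μ} := by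
  intro ξ hξ ξ' hξ' h
  refine labelChart_injOn hξ hξ' (funext fun μ => ?_)
  have hμ := congrFun h μ
  simpa only [labelChartAt, add_left_inj] using hμ

variable {k : ℕ} in
/-- The based chart is injective on the points of p19's cube at any block position `z` with `z_μ < 2L^{K−k}ML′_μ` (the hypothesis `hinj` of
FILE 12 §7's `abs_graphAmp_le_ampE` for the charts `c_v := labelChartAt b`). [cite: Balaban1983Higgs3, (2.13) p.426] -/
theorem labelChartAt_injOn_pts (hk : k ≤ P.K) (b : HiggsLattice.Site P 0) {z : Fin P.d → ℕ} (hz : ∀ μ, z μ < P.sitesPerDir k μ) :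
    Set.InjOn (labelChartAt P 0 b) ↑(pts P.L (⟨k, z⟩ : Cube P.d)) :=
  (labelChartAt_injOn b).mono fun _ hξ μ => label_lt_sitesPerDir_of_mem_pts hk hz (Finset.mem_coe.1 hξ) μ

variable {k : ℕ} in
/-- The same for the chart about the origin (FILE 12's `coordChart_injOn` for `z = boxOf y`). [cite: Balaban1983Higgs3, (2.13) p.426] -/
theorem labelChart_injOn_pts (hk : k ≤ P.K) {z : Fin P.d → ℕ} (hz : ∀ μ, z μ < P.sitesPerDir k μ) :
    Set.InjOn (labelChart P 0) ↑(pts P.L (⟨k, z⟩ : Cube P.d)) :=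
  labelChart_injOn.mono fun _ hξ μ => label_lt_sitesPerDir_of_mem_pts hk hz (Finset.mem_coe.1 hξ) μ

/-- **The torus distance of based-charted labels does not see the base point** (translation invariance of (I.1.3)).
[cite: Balaban1982Higgs1, (1.3) p.604] -/
theorem tdist_labelChartAt (b : HiggsLattice.Site P i) (ξ ξ' : Fin P.d → ℕ) :
    HiggsLattice.Site.tdist (labelChartAt P i b ξ) (labelChartAt P i b ξ') =
      HiggsLattice.Site.tdist (labelChart P i ξ) (labelChart P i ξ') :=
  tdist_add_right (labelChart P i ξ) (labelChart P i ξ') b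

/-- `tdist (chart_b ξ) (chart_b ξ′) ≦ supDist ξ ξ′` — always. [cite: Balaban1982Higgs1, (1.3) p.604] [cite: Balaban1983Higgs3, (2.10) p.426] -/
theorem tdist_labelChartAt_le_supDist (b : HiggsLattice.Site P i) (ξ ξ' : Fin P.d → ℕ) :
    HiggsLattice.Site.tdist (labelChartAt P i b ξ) (labelChartAt P i b ξ') ≤ supDist ξ ξ' := by
  rw [tdist_labelChartAt]
  exact tdist_labelChart_le_supDist ξ ξ'

/-- `tdist (chart_b ξ) (chart_b ξ′) = supDist ξ ξ′` off the seam. [cite: Balaban1982Higgs1, (1.3) p.604] [cite: Balaban1983Higgs3, (2.10) p.426] -/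
theorem tdist_labelChartAt_eq_supDist (b : HiggsLattice.Site P i) {ξ ξ' : Fin P.d → ℕ}
    (hnw : ∀ μ, 2 * Nat.dist (ξ μ) (ξ' μ) ≤ P.sitesPerDir i μ) :
    HiggsLattice.Site.tdist (labelChartAt P i b ξ) (labelChartAt P i b ξ') = supDist ξ ξ' := by
  rw [tdist_labelChartAt]
  exact tdist_labelChart_eq_supDist hnw

/-- … in particular for half-box labels. [cite: Balaban1982Higgs1, (1.3) p.604] [cite: Balaban1983Higgs3, (2.10) p.426] -/
theorem tdist_labelChartAt_eq_supDist_of_lt_half (b : HiggsLattice.Site P i) {ξ ξ' : Fin P.d → ℕ}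
    (hξ : ∀ μ, ξ μ < P.halfPerDir i μ) (hξ' : ∀ μ, ξ' μ < P.halfPerDir i μ) :
    HiggsLattice.Site.tdist (labelChartAt P i b ξ) (labelChartAt P i b ξ') = supDist ξ ξ' :=
  tdist_labelChartAt_eq_supDist b (noWrap_of_lt_half hξ hξ')

/-- **Every site within torus distance `D` of `p` (`2D < L^{K−i}ML′_μ`) is the based chart about `p − D` of an honest HALF-BOX label** (namely of
the labels of its translate by `D − p`, §6). [cite: Balaban1982Higgs1, (1.3) p.604] [cite: Balaban1983Higgs3, (2.13) p.426] -/
theorem exists_halfLabel_eq_labelChartAt {x p : HiggsLattice.Site P i} {D : ℕ} (h : HiggsLattice.Site.tdist x p ≤ D)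
    (hD : ∀ μ, 2 * D < P.halfPerDir i μ) :
    ∃ ξ : Fin P.d → ℕ, (∀ μ, ξ μ < P.halfPerDir i μ) ∧
      labelChartAt P i (fun μ => p μ - ((D : ℕ) : ZMod (P.sitesPerDir i μ))) ξ = x := by
  refine ⟨labelsOf (P := P) (i := i) fun μ => x μ + (((D : ℕ) : ZMod (P.sitesPerDir i μ)) - p μ),
    val_translate_lt_half h hD, funext fun μ => ?_⟩
  rw [labelChartAt, labelChart_labelsOf]
  ring

variable {k : ℕ}

/-- **The blockwise seam about a base point**: for two blocks in the half-box of labels the torus distance of based-charted points IS the box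
distance. [cite: Balaban1982Higgs1, (1.3) p.604] [cite: Balaban1983Higgs3, (2.13) p.426] -/
theorem tdist_labelChartAt_eq_supDist_of_blocks (hk : k ≤ P.K) (b : HiggsLattice.Site P 0) {z z' : Fin P.d → ℕ}
    (hz : ∀ μ, z μ < P.halfPerDir k μ) (hz' : ∀ μ, z' μ < P.halfPerDir k μ) {ξ ξ' : Fin P.d → ℕ}
    (hξ : ξ ∈ pts P.L (⟨k, z⟩ : Cube P.d)) (hξ' : ξ' ∈ pts P.L (⟨k, z'⟩ : Cube P.d)) :
    HiggsLattice.Site.tdist (labelChartAt P 0 b ξ) (labelChartAt P 0 b ξ') = supDist ξ ξ' := by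
  rw [tdist_labelChartAt]
  exact tdist_labelChart_eq_supDist_of_blocks hk hz hz' hξ hξ'

/-- **THE LINE BOUND (2.10) THROUGH A BASED CHART**: a torus bound `|G x x′| ≦ C s^a exp(−δ₁ s^{−1}((L^k)^{−1}·tdist x x′))`, `s = L^j(L^k)^{−1}`, on
`T_η` yields p19's `K_le` body for the kernel read through `labelChartAt b`, for all points of two blocks in the half-box of labels — for EVERY base
point `b`, with no invariance property of `G`. [cite: Balaban1983Higgs3, (2.10) p.426] [cite: Balaban1983Higgs3, (2.13) p.426] -/
theorem lineBound_labelChartAt_of_torusBound (hk : k ≤ P.K) (b : HiggsLattice.Site P 0)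
    {G : HiggsLattice.Site P 0 → HiggsLattice.Site P 0 → ℝ} {C a δ₁ : ℝ} {j : ℕ}
    (hG : ∀ x x', |G x x'| ≤ C * ((P.L : ℝ) ^ j * ((P.L : ℝ) ^ k)⁻¹) ^ a *
      Real.exp (-(δ₁ * ((P.L : ℝ) ^ j * ((P.L : ℝ) ^ k)⁻¹)⁻¹ *
        (((P.L : ℝ) ^ k)⁻¹ * (HiggsLattice.Site.tdist x x' : ℝ)))))
    {z z' : Fin P.d → ℕ} (hz : ∀ μ, z μ < P.halfPerDir k μ) (hz' : ∀ μ, z' μ < P.halfPerDir k μ) :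
    ∀ ξ ∈ pts P.L (⟨k, z⟩ : Cube P.d), ∀ ξ' ∈ pts P.L (⟨k, z'⟩ : Cube P.d),
      |G (labelChartAt P 0 b ξ) (labelChartAt P 0 b ξ')| ≤ C * ((P.L : ℝ) ^ j * ((P.L : ℝ) ^ k)⁻¹) ^ a *
        Real.exp (-(2 * (δ₁ / 2) / ((P.L : ℝ) ^ j * ((P.L : ℝ) ^ k)⁻¹) *
          (((P.L : ℝ) ^ k)⁻¹ * (supDist ξ ξ' : ℝ)))) := by
  intro ξ hξ ξ' hξ'
  have h := hG (labelChartAt P 0 b ξ) (labelChartAt P 0 b ξ')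
  rw [tdist_labelChartAt_eq_supDist_of_blocks hk b hz hz' hξ hξ'] at h
  have e : 2 * (δ₁ / 2) / ((P.L : ℝ) ^ j * ((P.L : ℝ) ^ k)⁻¹) = δ₁ * ((P.L : ℝ) ^ j * ((P.L : ℝ) ^ k)⁻¹)⁻¹ := by ring
  rw [e]
  exact h

/-- The same in FILE 16's literal output shape (`(setupAt S k).spacing j`, `(setupAt S k).eps`). [cite: Balaban1983Higgs3, (2.10) p.426]
[cite: Balaban1983Higgs3, (2.13) p.426] -/
theorem lineBound_labelChartAt_of_torusBound_setupAt {S : Shape P} (hk : k ≤ P.K) (b : HiggsLattice.Site P 0)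
    {G : HiggsLattice.Site P 0 → HiggsLattice.Site P 0 → ℝ} {C a δ₁ : ℝ} {j : ℕ}
    (hG : ∀ x x', |G x x'| ≤ C * (setupAt S k).spacing j ^ a *
      Real.exp (-(δ₁ * ((setupAt S k).spacing j)⁻¹ * ((setupAt S k).eps * (HiggsLattice.Site.tdist x x' : ℝ)))))
    {z z' : Fin P.d → ℕ} (hz : ∀ μ, z μ < P.halfPerDir k μ) (hz' : ∀ μ, z' μ < P.halfPerDir k μ) :
    ∀ ξ ∈ pts P.L (⟨k, z⟩ : Cube P.d), ∀ ξ' ∈ pts P.L (⟨k, z'⟩ : Cube P.d),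
      |G (labelChartAt P 0 b ξ) (labelChartAt P 0 b ξ')| ≤ C * ((P.L : ℝ) ^ j * ((P.L : ℝ) ^ k)⁻¹) ^ a *
        Real.exp (-(2 * (δ₁ / 2) / ((P.L : ℝ) ^ j * ((P.L : ℝ) ^ k)⁻¹) *
          (((P.L : ℝ) ^ k)⁻¹ * (supDist ξ ξ' : ℝ)))) := by
  rw [spacing_setupAt, eps_setupAt] at hG
  exact lineBound_labelChartAt_of_torusBound hk b hG hz hz'

end BasedChart


/-! ## §8 Blocks about a base block: the block map commutes with block-lattice translations, and the based block chart -/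

section BasedBlocks

open Literature.MathematicalPhysics.QuantumFieldTheory.Balaban1983to89.HiggsAveraging (blockIter blockK mem_blockK)
open Literature.MathematicalPhysics.QuantumFieldTheory.Balaban1983to89.B1Eq214Concrete (val_blockOf)

variable {P : HiggsLattice.Params} {k : ℕ}

/-- Labels of the iterated block map: `(x_k)_μ = x_μ div L^k` (`k ≦ K`).  This is FILE 12's PUBLIC
`B3GraphAmplitudePositionForm.val_blockIter`; a PRIVATE copy is kept here because FILE 12 sits ABOVE this file in the import DAG (FILE 12's
consumers import the seam, not conversely) — use FILE 12's declaration everywhere else.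
-- TODO(dedup): move `val_blockIter` below both files (the `HiggsAveraging` ∕ `B1Eq214Concrete` layer) and delete both copies.
[cite: Balaban1982Higgs1, (2.2) p.608] -/
private theorem val_blockIter (hk : k ≤ P.K) (x : HiggsLattice.Site P 0) (μ : Fin P.d) :
    ((blockIter k x) μ).val = (x μ).val / P.L ^ k := by
  induction k with
  | zero => simp [blockIter]
  | succ k ih =>
    show ((HiggsLattice.blockOf (blockIter k x)) μ).val = (x μ).val / P.L ^ (k + 1)
    rw [val_blockOf (by omega), ih (by omega), pow_succ, Nat.div_div_eq_div_mul]

/-- **The corner of a block** `c ∈ T^{(k)}` in `T_η`: the site with labels `c_μ L^k` (the point of `B^k(c)` with the least labels).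
[cite: Balaban1982Higgs1, (1.17) p.606] -/
def blockCorner (c : HiggsLattice.Site P k) : HiggsLattice.Site P 0 := labelChart P 0 fun μ => (c μ).val * P.L ^ k

/-- Labels of the corner: `c_μ L^k` (honest for `k ≦ K`). [cite: Balaban1982Higgs1, (1.17) p.606] -/
theorem val_blockCorner (hk : k ≤ P.K) (c : HiggsLattice.Site P k) (μ : Fin P.d) :
    (blockCorner c μ).val = (c μ).val * P.L ^ k := by
  refine val_labelChart ?_
  rw [sitesPerDir_zero_eq_mul hk, mul_comm]
  exact Nat.mul_lt_mul_of_pos_left (ZMod.val_lt (c μ)) (pow_pos P.hL k)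

/-- kernel arithmetic of the borrow case: `(qn − (bq − a)) div q = n − (b − a div q)` for `a < bq`, `b < n`. [folklore] -/
private theorem borrow_div (a b q n : ℕ) (hq : 0 < q) (hab : a < b * q) (hbn : b < n) :
    (q * n - (b * q - a)) / q = n - (b - a / q) := by
  have hy : a / q < b := (Nat.div_lt_iff_lt_mul hq).2 hab
  have h1 : a ≤ q * b := by rw [mul_comm]; exact hab.le
  have h2 : q * b - a ≤ q * n := le_trans (Nat.sub_le _ _) (Nat.mul_le_mul_left q hbn.le)
  have e : q * n - (b * q - a) = a + (n - b) * q := by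
    rw [mul_comm b q]
    zify [h1, h2, hbn.le]
    ring
  rw [e, Nat.add_mul_div_right _ _ hq]
  generalize a / q = y at hy ⊢
  omega

/-- **THE BLOCK MAP COMMUTES WITH BLOCK-LATTICE TRANSLATIONS**: `(x − corner c)_k = x_k − c` — translating `T_η` by the corner of a
block `c ∈ T^{(k)}` translates the blocks by `c`. [cite: Balaban1982Higgs1, (1.17) p.606] [cite: Balaban1982Higgs1, (2.2) p.608] -/
theorem blockIter_sub_blockCorner (hk : k ≤ P.K) (x : HiggsLattice.Site P 0) (c : HiggsLattice.Site P k) :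
    blockIter k (fun μ => x μ - blockCorner c μ) = fun μ => blockIter k x μ - c μ := by
  funext μ
  apply ZMod.val_injective
  rw [val_blockIter hk]
  -- notation: `a = x_μ`, `b = c_μ`, `q = L^k`, `n = 2L^{K−k}ML′_μ`, `(x_k)_μ = a div q`
  have hq : 0 < P.L ^ k := pow_pos P.hL k
  have hn0 : P.sitesPerDir 0 μ = P.L ^ k * P.sitesPerDir k μ := sitesPerDir_zero_eq_mul hk μ
  have hcor : (blockCorner c μ).val = (c μ).val * P.L ^ k := val_blockCorner hk c μ
  have hy : ((blockIter k x) μ).val = (x μ).val / P.L ^ k := val_blockIter hk x μ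
  have hb : (c μ).val < P.sitesPerDir k μ := ZMod.val_lt (c μ)
  by_cases hle : (c μ).val * P.L ^ k ≤ (x μ).val
  · -- no borrow: `(a − bq) div q = a div q − b`
    have hle' : (c μ).val ≤ (x μ).val / P.L ^ k := (Nat.le_div_iff_mul_le hq).2 hle
    rw [ZMod.val_sub (by rw [hcor]; exact hle), hcor, ZMod.val_sub (by rw [hy]; exact hle'), hy]
    rw [mul_comm, Nat.sub_mul_div]
  · -- borrow: `(qn − (bq − a)) div q = n − (b − a div q)`
    push Not at hle
    have hlt' : (x μ).val / P.L ^ k < (c μ).val := (Nat.div_lt_iff_lt_mul hq).2 hle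
    have hne : blockCorner c μ - x μ ≠ 0 := by
      intro h0
      have := congrArg ZMod.val h0
      rw [ZMod.val_sub (by rw [hcor]; exact hle.le), hcor, ZMod.val_zero] at this
      omega
    have hne' : c μ - blockIter k x μ ≠ 0 := by
      intro h0
      have := congrArg ZMod.val h0
      rw [ZMod.val_sub (by rw [hy]; exact hlt'.le), hy, ZMod.val_zero] at this
      omega
    rw [← neg_sub, ZMod.neg_val, if_neg hne, ZMod.val_sub (by rw [hcor]; exact hle.le), hcor]
    rw [← neg_sub, ZMod.neg_val, if_neg hne', ZMod.val_sub (by rw [hy]; exact hlt'.le), hy]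
    have key := borrow_div (x μ).val (c μ).val (P.L ^ k) (P.sitesPerDir k μ) hq hle hb
    rw [← hn0] at key
    exact key

/-- The points of p19's cube at the block position `labelsOf y` chart `B^k(y)`: `x ∈ B^k(y)` iff `x = labelChart ξ` for a lattice point `ξ`
of the cube `⟨k, labelsOf y⟩`.  This is FILE 12's PUBLIC `B3GraphAmplitudePositionForm.mem_blockK_iff_exists_coordChart` (`coordChart P =
labelChart P 0`, `boxOf = labelsOf`, both `rfl`); PRIVATE stepping stone here for the based version below, for the same DAG reason as
`val_blockIter` — use FILE 12's declaration everywhere else. [cite: Balaban1983Higgs3, (2.13) p.426] [cite: Balaban1982Higgs1, (1.20) p.607] -/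
private theorem mem_blockK_iff_exists_labelChart (hk : k ≤ P.K) (y : HiggsLattice.Site P k) (x : HiggsLattice.Site P 0) :
    x ∈ blockK k y ↔ ∃ ξ ∈ pts P.L (⟨k, labelsOf y⟩ : Cube P.d), labelChart P 0 ξ = x := by
  have hq : 0 < P.L ^ k := pow_pos P.hL k
  rw [mem_blockK]
  constructor
  · intro h
    refine ⟨labelsOf x, (mem_pts_iff_label P.hL k (labelsOf y) (labelsOf x)).2 fun μ => ?_, labelChart_labelsOf x⟩
    have hμ : (x μ).val / P.L ^ k = (y μ).val := by rw [← val_blockIter hk x μ, h]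
    rw [labelsOf_apply, labelsOf_apply, ← hμ]
    refine ⟨Nat.div_mul_le_self _ _, ?_⟩
    rw [Nat.add_mul, one_mul]
    exact Nat.lt_div_mul_add hq
  · rintro ⟨ξ, hξ, rfl⟩
    funext μ
    apply ZMod.val_injective
    have hb := (mem_pts_iff_label P.hL k (labelsOf y) ξ).1 hξ μ
    rw [labelsOf_apply] at hb
    rw [val_blockIter hk, val_labelChart (label_lt_sitesPerDir_of_mem_pts hk (fun ν => labelsOf_lt y ν) hξ μ)]
    apply le_antisymm
    · exact Nat.lt_succ_iff.1 ((Nat.div_lt_iff_lt_mul hq).2 hb.2)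
    · exact (Nat.le_div_iff_mul_le hq).2 hb.1

/-- **THE BASED BLOCK CHART**: for any base block `c ∈ T^{(k)}`, `x ∈ B^k(y)` iff `x = labelChartAt (blockCorner c) ξ` for a lattice point `ξ`
of p19's cube at the RELATIVE block position `labelsOf (y − c)` — so a block-localized configuration anywhere on the torus whose blocks lie
within half a half-period of `c` is charted by honest half-box label boxes (§7), with no wrap-around. [cite: Balaban1983Higgs3, (2.13) p.426]
[cite: Balaban1982Higgs1, (1.20) p.607] -/
theorem mem_blockK_iff_exists_labelChartAt (hk : k ≤ P.K) (c y : HiggsLattice.Site P k) (x : HiggsLattice.Site P 0) :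
    x ∈ blockK k y ↔ ∃ ξ ∈ pts P.L (⟨k, labelsOf (P := P) (i := k) fun μ => y μ - c μ⟩ : Cube P.d),
      labelChartAt P 0 (blockCorner c) ξ = x := by
  -- `x ∈ B^k(y)` iff `x − corner c ∈ B^k(y − c)` (equivariance), then the unbased chart of `B^k(y − c)`
  set x' : HiggsLattice.Site P 0 := fun μ => x μ - blockCorner c μ with hx'
  set y' : HiggsLattice.Site P k := fun μ => y μ - c μ with hy'
  have h1 : x ∈ blockK k y ↔ x' ∈ blockK k y' := by
    rw [mem_blockK, mem_blockK, hx', blockIter_sub_blockCorner hk]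
    constructor
    · intro h
      funext μ
      show blockIter k x μ - c μ = y μ - c μ
      rw [show blockIter k x μ = y μ from congrFun h μ]
    · intro h
      funext μ
      exact sub_left_injective (congrFun h μ)
  rw [h1, mem_blockK_iff_exists_labelChart hk y' x']
  refine exists_congr fun ξ => and_congr_right fun _ => ?_
  constructor
  · intro h
    funext μ
    show labelChart P 0 ξ μ + blockCorner c μ = x μ
    rw [show labelChart P 0 ξ μ = x μ - blockCorner c μ from congrFun h μ, sub_add_cancel]
  · intro h
    funext μ
    show labelChart P 0 ξ μ = x μ - blockCorner c μ
    rw [← show labelChart P 0 ξ μ + blockCorner c μ = x μ from congrFun h μ, add_sub_cancel_right]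

/-- **Choosing the base block**: if every block `y` of a configuration lies within torus distance `D` of a reference block `p ∈ T^{(k)}` and
`2D < L^{K−k}ML′_μ`, then with the base block `c₀ := p − D` all RELATIVE block positions `labelsOf (y − c₀)` lie in the half-box — the
hypothesis `hz` of `lineBound_labelChartAt_of_torusBound` ∕ `tdist_labelChartAt_eq_supDist_of_blocks` for the charts about `blockCorner c₀`
(§6's `val_translate_lt_half` at level `k`). [cite: Balaban1982Higgs1, (1.3) p.604] [cite: Balaban1983Higgs3, (2.13) p.426] -/
theorem relLabels_lt_half_of_tdist_le {y p : HiggsLattice.Site P k} {D : ℕ} (h : HiggsLattice.Site.tdist y p ≤ D)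
    (hD : ∀ μ, 2 * D < P.halfPerDir k μ) (μ : Fin P.d) :
    labelsOf (P := P) (i := k) (fun ν => y ν - (p ν - ((D : ℕ) : ZMod (P.sitesPerDir k ν)))) μ < P.halfPerDir k μ := by
  show (y μ - (p μ - ((D : ℕ) : ZMod (P.sitesPerDir k μ)))).val < P.halfPerDir k μ
  have e : y μ - (p μ - ((D : ℕ) : ZMod (P.sitesPerDir k μ))) = y μ + (((D : ℕ) : ZMod (P.sitesPerDir k μ)) - p μ) := by ring
  rw [e]
  exact val_translate_lt_half h hD μ

end BasedBlocks

end Literature.MathematicalPhysics.QuantumFieldTheory.Balaban1983to89.B3Eq213TorusBoxSeam
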